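import Summits.HubbardSuperconductivity.HubbardSuperconductivity.Theorems.AnisotropyChordTransferFibre3RowDLoopNorms
import Summits.HubbardSuperconductivity.HubbardSuperconductivity.Theorems.AnisotropyChordTransferFibre3RowDTLoopTables
import Summits.HubbardSuperconductivity.HubbardSuperconductivity.Theorems.AnisotropyChordTransferFibre3ManifoldA64

/-!
# Route `AnisotropyChord` / H0 rotor rung, row D (KT-2a) on the t-BLOCKS: block twin of `…AnisotropyChordTransferFibre3RowDLoopNorms`

T-FORK (p2 g8; inventory memo HOME/hubbard-h0-rotor-p2/TBLOCK-INVENTORY-g8.md §3): the theorems of `…RowDLoopNorms` that carry the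
hypothesis `128 ≤ L` (or the `L2.NamedCell` cell box) restated in the namespace `RowD.T` with the SAME names for the t-blocks of
the range `48 ≤ L < 128` (route-lead ruling R1): analytic layer with `64 ≤ L` (family A at `L ≥ 64`: `ManifoldA.nu_ceiling64`,
`manifold_band64`), cell layer on block cells `c : L2.TCell` (`cellBoxB (c.box a₁ a₂)`, `pmem_xTrueT`,
`RowC.finalVec_mem_of_cellFinalBoxT`).  Definitions that do not depend on the cell are NOT duplicated (they resolve to `RowD`);
proofs are verbatim.  Kept: norm_loopPartU_w12_le, norm_loopPartU_w31_le, norm_loopPartU_w32_le, norm_loopPartU_plain_le, norm_nLoopU_le, norm_nvLoopU_le, norm_mLoopU_le.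
Prover seat `hubbard-h0-rotor-p2` g8; helper for piece A = stmt-HubbardSuperconductivity-23918 of rung 19089 (`--supports`, helper
class).  Nothing here proves superconductivity in the Hubbard model; lemmas for ONE row of ONE conditional reduction on the t-blocks;
the rotor TARGET as originally worded stays FALSE (g15 verdict).  Tree imports only; no sorry.
-/

set_option linter.dupNamespace false
set_option autoImplicit false

open scoped BigOperators

namespace Summit.HubbardSuperconductivity.HubbardSuperconductivity.Theorems.AnisotropyChord.Transfer.Fibre3

namespace RowD

namespace T

open RowC L2.N1

variable (L : ℕ) [NeZero L]

/-! ## One typed `loopPartU` -/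

section one
variable (Δ lam2 : ℝ) (f : Tor L → ℝ)

/-- ★ pattern `w12` (slot 3 plain): `‖loopPartU(ψ₃⁰, ψ₁ʷ, ψ₂ʷ′)‖ ≤ bnd3(k3; k1, k2)/V`. [folklore] -/
theorem norm_loopPartU_w12_le (hL : 64 ≤ L) (hΔ0 : 0 ≤ Δ) (hΔ1 : Δ < 1) (hf : IsGroundTwoMagnon L Δ lam2 f) (k3 k1 k2 : Bool) (e0 : Tor L) {e e' : ℤ × ℤ}
    (he : e ∈ E4) (he' : e' ∈ E4) (k₂ k₃ : Tor L) :
    ‖loopPartU L lam2 (psiU L Δ lam2 f k3 1 0 e0) (psiU L Δ lam2 f k1 1 (-1) (B1.toTor L e)) (psiU L Δ lam2 f k2 1 (-1) (B1.toTor L e')) k₂ k₃‖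
      ≤ bnd3At L Δ lam2 f k3 k1 k2 / (L : ℝ) ^ 2 := by
  rw [norm_loopPartU_eq]
  have h := norm_loop3w_le L Δ lam2 f hL hΔ0 hΔ1 hf k3 k1 k2 e0 he he' false 0 false k₂ true k₃
  simp only [affine_false, affine_true, zero_add] at h
  exact div_le_div_of_nonneg_right h (by positivity)

/-- ★ pattern `w31` (slot 2 plain): `‖loopPartU(ψ₃ʷ, ψ₁ʷ′, ψ₂⁰)‖ ≤ bnd3(k2; k3, k1)/V`. [folklore] -/
theorem norm_loopPartU_w31_le (hL : 64 ≤ L) (hΔ0 : 0 ≤ Δ) (hΔ1 : Δ < 1) (hf : IsGroundTwoMagnon L Δ lam2 f) (k3 k1 k2 : Bool) (e0 : Tor L) {e e' : ℤ × ℤ}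
    (he : e ∈ E4) (he' : e' ∈ E4) (k₂ k₃ : Tor L) :
    ‖loopPartU L lam2 (psiU L Δ lam2 f k3 1 (-1) (B1.toTor L e)) (psiU L Δ lam2 f k1 1 (-1) (B1.toTor L e')) (psiU L Δ lam2 f k2 1 0 e0) k₂ k₃‖
      ≤ bnd3At L Δ lam2 f k2 k3 k1 / (L : ℝ) ^ 2 := by
  rw [norm_loopPartU_eq]
  have h := norm_loop3w_le L Δ lam2 f hL hΔ0 hΔ1 hf k2 k3 k1 e0 he he' true k₃ false 0 false k₂
  simp only [affine_false, affine_true, zero_add] at h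
  refine div_le_div_of_nonneg_right (le_of_eq_of_le ?_ h) (by positivity)
  congr 1; exact Finset.sum_congr rfl fun p _ => by ring

/-- ★ pattern `w32` (slot 1 plain): `‖loopPartU(ψ₃ʷ, ψ₁⁰, ψ₂ʷ′)‖ ≤ bnd3(k1; k3, k2)/V`. [folklore] -/
theorem norm_loopPartU_w32_le (hL : 64 ≤ L) (hΔ0 : 0 ≤ Δ) (hΔ1 : Δ < 1) (hf : IsGroundTwoMagnon L Δ lam2 f) (k3 k1 k2 : Bool) (e0 : Tor L) {e e' : ℤ × ℤ}
    (he : e ∈ E4) (he' : e' ∈ E4) (k₂ k₃ : Tor L) :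
    ‖loopPartU L lam2 (psiU L Δ lam2 f k3 1 (-1) (B1.toTor L e)) (psiU L Δ lam2 f k1 1 0 e0) (psiU L Δ lam2 f k2 1 (-1) (B1.toTor L e')) k₂ k₃‖
      ≤ bnd3At L Δ lam2 f k1 k3 k2 / (L : ℝ) ^ 2 := by
  rw [norm_loopPartU_eq]
  have h := norm_loop3w_le L Δ lam2 f hL hΔ0 hΔ1 hf k1 k3 k2 e0 he he' false k₂ false 0 true k₃
  simp only [affine_false, affine_true, zero_add] at h
  refine div_le_div_of_nonneg_right (le_of_eq_of_le ?_ h) (by positivity)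
  congr 1; exact Finset.sum_congr rfl fun p _ => by ring

/-- ★ three plain slots: `‖loopPartU(ψ₃⁰, ψ₁⁰, ψ₂⁰)‖ ≤ bndM(k3,k1,k2)/V`. [folklore] -/
theorem norm_loopPartU_plain_le (hL : 64 ≤ L) (hΔ0 : 0 ≤ Δ) (hΔ1 : Δ < 1) (hf : IsGroundTwoMagnon L Δ lam2 f) (k3 k1 k2 : Bool) (e3 e1 e2 : Tor L) (k₂ k₃ : Tor L) :
    ‖loopPartU L lam2 (psiU L Δ lam2 f k3 1 0 e3) (psiU L Δ lam2 f k1 1 0 e1) (psiU L Δ lam2 f k2 1 0 e2) k₂ k₃‖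
      ≤ bndMAt L Δ lam2 f k3 k1 k2 / (L : ℝ) ^ 2 := by
  rw [norm_loopPartU_eq]
  have h := norm_loop3u_le L Δ lam2 f hL hΔ0 hΔ1 hf k3 k1 k2 e3 e1 e2 false 0 false k₂ true k₃
  simp only [affine_false, affine_true, zero_add] at h
  exact div_le_div_of_nonneg_right h (by positivity)

end one

/-! ## The `N`-loops -/

section nloops
variable (Δ lam2 : ℝ) (f : Tor L → ℝ)

/-- ★ `‖nLoopU(q₂,q₃)‖ ≤ 2·bnd3Sum/V` (four `e ∈ nnList`, prefactor `½`). [folklore] -/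
theorem norm_nLoopU_le (hL : 64 ≤ L) (hΔ0 : 0 ≤ Δ) (hΔ1 : Δ < 1) (hf : IsGroundTwoMagnon L Δ lam2 f) (k3 k1 k2 : Bool) (e0 q₂ q₃ : Tor L) :
    ‖nLoopU L Δ lam2 f k3 k1 k2 e0 q₂ q₃‖ ≤ 2 * (bnd3Sum L Δ lam2 f k3 k1 k2 / (L : ℝ) ^ 2) := by
  have T : ∀ e ∈ E4,
      ‖loopPartU L lam2 (psiU L Δ lam2 f k3 1 0 e0) (psiU L Δ lam2 f k1 1 (-1) (B1.toTor L e)) (psiU L Δ lam2 f k2 1 (-1) (B1.toTor L e)) q₂ q₃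
        + loopPartU L lam2 (psiU L Δ lam2 f k3 1 (-1) (B1.toTor L e)) (psiU L Δ lam2 f k1 1 (-1) (-(B1.toTor L e))) (psiU L Δ lam2 f k2 1 0 e0) q₂ q₃
        + loopPartU L lam2 (psiU L Δ lam2 f k3 1 (-1) (B1.toTor L e)) (psiU L Δ lam2 f k1 1 0 e0) (psiU L Δ lam2 f k2 1 (-1) (B1.toTor L e)) q₂ q₃‖
      ≤ bnd3Sum L Δ lam2 f k3 k1 k2 / (L : ℝ) ^ 2 := by
    intro e he
    have hne := neg_mem_E4 e he
    have A := norm_loopPartU_w12_le L Δ lam2 f hL hΔ0 hΔ1 hf k3 k1 k2 e0 he he q₂ q₃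
    have B := norm_loopPartU_w31_le L Δ lam2 f hL hΔ0 hΔ1 hf k3 k1 k2 e0 he hne q₂ q₃
    have C := norm_loopPartU_w32_le L Δ lam2 f hL hΔ0 hΔ1 hf k3 k1 k2 e0 he he q₂ q₃
    rw [B1.toTor_neg] at B
    unfold bnd3Sum
    calc _ ≤ ‖loopPartU L lam2 (psiU L Δ lam2 f k3 1 0 e0) (psiU L Δ lam2 f k1 1 (-1) (B1.toTor L e)) (psiU L Δ lam2 f k2 1 (-1) (B1.toTor L e)) q₂ q₃
          + loopPartU L lam2 (psiU L Δ lam2 f k3 1 (-1) (B1.toTor L e)) (psiU L Δ lam2 f k1 1 (-1) (-(B1.toTor L e))) (psiU L Δ lam2 f k2 1 0 e0) q₂ q₃‖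
          + ‖loopPartU L lam2 (psiU L Δ lam2 f k3 1 (-1) (B1.toTor L e)) (psiU L Δ lam2 f k1 1 0 e0) (psiU L Δ lam2 f k2 1 (-1) (B1.toTor L e)) q₂ q₃‖ :=
          norm_add_le _ _
      _ ≤ _ := by
          have := norm_add_le
            (loopPartU L lam2 (psiU L Δ lam2 f k3 1 0 e0) (psiU L Δ lam2 f k1 1 (-1) (B1.toTor L e)) (psiU L Δ lam2 f k2 1 (-1) (B1.toTor L e)) q₂ q₃)
            (loopPartU L lam2 (psiU L Δ lam2 f k3 1 (-1) (B1.toTor L e)) (psiU L Δ lam2 f k1 1 (-1) (-(B1.toTor L e))) (psiU L Δ lam2 f k2 1 0 e0) q₂ q₃)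
          rw [add_div, add_div]
          linarith
  have e1 := T (1, 0) (by decide)
  have e2 := T (-1, 0) (by decide)
  have e3 := T (0, 1) (by decide)
  have e4 := T (0, -1) (by decide)
  unfold nLoopU
  rw [nnList_eq_map]
  simp only [E4, List.map, List.sum_cons, List.sum_nil, add_zero, norm_mul, norm_neg, norm_div, norm_one,
    Complex.norm_ofNat]
  have hs := norm_add_le_of_le e1 (norm_add_le_of_le e2 (norm_add_le_of_le e3 e4))
  refine (mul_le_mul_of_nonneg_left hs (by norm_num)).trans (le_of_eq ?_)
  ring

/-- ★ `‖nvLoopU(k₂,k₃)‖ ≤ 6·bnd3Sum/V` (three translates). [folklore] -/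
theorem norm_nvLoopU_le (hL : 64 ≤ L) (hΔ0 : 0 ≤ Δ) (hΔ1 : Δ < 1) (hf : IsGroundTwoMagnon L Δ lam2 f) (k3 k1 k2 : Bool) (e0 k₂ k₃ : Tor L) :
    ‖nvLoopU L Δ lam2 f k3 k1 k2 e0 k₂ k₃‖ ≤ 6 * (bnd3Sum L Δ lam2 f k3 k1 k2 / (L : ℝ) ^ 2) := by
  unfold nvLoopU
  have h1 := norm_nLoopU_le L Δ lam2 f hL hΔ0 hΔ1 hf k3 k1 k2 e0 k₂ k₃
  have h2 := norm_nLoopU_le L Δ lam2 f hL hΔ0 hΔ1 hf k3 k1 k2 e0 (k₂ - K1 L) k₃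
  have h3 := norm_nLoopU_le L Δ lam2 f hL hΔ0 hΔ1 hf k3 k1 k2 e0 k₂ (k₃ - K1 L)
  have := norm_add_le_of_le (norm_add_le_of_le h1 h2) h3
  linarith

end nloops

/-! ## The `M`-loops at integer momenta -/

section mloops
variable (Δ lam2 : ℝ) (f : Tor L → ℝ)

/-- ★ `‖mLoopU(k̄₂,k̄₃)‖ ≤ θ²·mMult·bndM/V` (kinds `(k3,k1,k2)`, integer momenta). [folklore] -/
theorem norm_mLoopU_le (hL : 64 ≤ L) (hΔ0 : 0 ≤ Δ) (hΔ1 : Δ < 1) (hf : IsGroundTwoMagnon L Δ lam2 f) (k3 k1 k2 : Bool) (e0 : Tor L) (k₂ k₃ : ℤ × ℤ) :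
    ‖mLoopU L Δ lam2 f k3 k1 k2 e0 (B1.toTor L k₂) (B1.toTor L k₃)‖
      ≤ (2 * Real.pi / L) ^ 2 * (mMult k₂ k₃ : ℝ) * (bndMAt L Δ lam2 f k3 k1 k2 / (L : ℝ) ^ 2) := by
  have hLpos : (0 : ℝ) < L := by exact_mod_cast (show 0 < L by omega)
  set θ : ℝ := 2 * Real.pi / L with hθ
  have hθ0 : 0 ≤ θ := by positivity
  set B : ℝ := bndMAt L Δ lam2 f k3 k1 k2 / (L : ℝ) ^ 2 with hB
  have hB0 : 0 ≤ B := by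
    have := norm_loopPartU_plain_le L Δ lam2 f hL hΔ0 hΔ1 hf k3 k1 k2 e0 e0 e0 0 0
    exact (norm_nonneg _).trans this
  -- the translated momenta on the torus
  have ht2 : B1.toTor L k₂ - K1 L = B1.toTor L (k₂ - exI) := by rw [K1_eq_toTor, ← RowC.toTor_sub]; rfl
  have ht3 : B1.toTor L k₃ - K1 L = B1.toTor L (k₃ - exI) := by rw [K1_eq_toTor, ← RowC.toTor_sub]; rfl
  have ht23 : B1.toTor L k₂ + B1.toTor L k₃ = B1.toTor L (k₂ + k₃) := by rw [B1.toTor_add]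
  obtain ⟨hex, hnex, -⟩ := toTor_named L
  -- one `e`-term
  have T : ∀ e : ℤ × ℤ, (e = (1, 0) ∨ e = (-1, 0)) →
      ‖(phase L (K1 L) (B1.toTor L e) - 1) *
        ( ((starRingEnd ℂ) (phase L (B1.toTor L k₂ + B1.toTor L k₃) (B1.toTor L e)) - 1)
            * loopPartU L lam2 (psiU L Δ lam2 f k3 1 0 e0) (psiU L Δ lam2 f k1 1 0 e0) (psiU L Δ lam2 f k2 1 0 e0) (B1.toTor L k₂) (B1.toTor L k₃)
        + (phase L (B1.toTor L k₂ - K1 L) (B1.toTor L e) - 1)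
            * loopPartU L lam2 (psiU L Δ lam2 f k3 1 0 e0) (psiU L Δ lam2 f k1 1 0 e0) (psiU L Δ lam2 f k2 1 0 e0) (B1.toTor L k₂ - K1 L) (B1.toTor L k₃)
        + (phase L (B1.toTor L k₃ - K1 L) (B1.toTor L e) - 1)
            * loopPartU L lam2 (psiU L Δ lam2 f k3 1 0 e0) (psiU L Δ lam2 f k1 1 0 e0) (psiU L Δ lam2 f k2 1 0 e0) (B1.toTor L k₂) (B1.toTor L k₃ - K1 L))‖
      ≤ θ * (θ * (mMult k₂ k₃ : ℝ) * B) := by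
    intro e he
    have ho := norm_outer_le L (by omega) he
    rw [ht23, ht2, ht3]
    have i0 := norm_inner_le L (k₂ + k₃) e
    have i1 := norm_inner_le' L (k₂ - exI) e
    have i2 := norm_inner_le' L (k₃ - exI) e
    have l0 := norm_loopPartU_plain_le L Δ lam2 f hL hΔ0 hΔ1 hf k3 k1 k2 e0 e0 e0 (B1.toTor L k₂) (B1.toTor L k₃)
    have l1 := norm_loopPartU_plain_le L Δ lam2 f hL hΔ0 hΔ1 hf k3 k1 k2 e0 e0 e0 (B1.toTor L (k₂ - exI)) (B1.toTor L k₃)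
    have l2 := norm_loopPartU_plain_le L Δ lam2 f hL hΔ0 hΔ1 hf k3 k1 k2 e0 e0 e0 (B1.toTor L k₂) (B1.toTor L (k₃ - exI))
    rw [← hB] at l0 l1 l2
    -- the multipliers along `e = ±x̂` equal those along `x̂`
    have habs : ∀ q : ℤ × ℤ, (qdot q e).natAbs = (qdot q exI).natAbs := by
      intro q; rcases he with rfl | rfl <;> simp [qdot, exI, Int.natAbs_neg]
    simp only [habs] at i0 i1 i2
    rw [norm_mul]
    refine mul_le_mul ho ?_ (norm_nonneg _) hθ0
    have s0 := norm_mul_le_of_le i0 l0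
    have s1 := norm_mul_le_of_le i1 l1
    have s2 := norm_mul_le_of_le i2 l2
    refine (norm_add_le_of_le (norm_add_le_of_le s0 s1) s2).trans (le_of_eq ?_)
    unfold mMult; push_cast; ring
  have e1 := T (1, 0) (Or.inl rfl)
  have e2 := T (-1, 0) (Or.inr rfl)
  unfold mLoopU
  rw [← hnex, ← hex]
  simp only [List.map, List.sum_cons, List.sum_nil, add_zero, norm_mul, norm_neg, norm_div, norm_one, Complex.norm_ofNat]
  have hs := norm_add_le_of_le e1 e2
  calc 1 / 2 * _ ≤ 1 / 2 * (θ * (θ * (mMult k₂ k₃ : ℝ) * B) + θ * (θ * (mMult k₂ k₃ : ℝ) * B)) :=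
        mul_le_mul_of_nonneg_left hs (by norm_num)
    _ = θ ^ 2 * (mMult k₂ k₃ : ℝ) * B := by ring

end mloops

end T

end RowD

end Summit.HubbardSuperconductivity.HubbardSuperconductivity.Theorems.AnisotropyChord.Transfer.Fibre3
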